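import Literature.Topology.FourManifolds.DehnSurgeryFramingProofs
import Literature.AlgebraicTopology.SingularHomology.HurewiczOne
import Literature.AlgebraicTopology.SingularHomology.MayerVietorisExactness
import Literature.AlgebraicTopology.SingularHomology.ExcisionMayerVietorisProofs
import HarnessLib

/-!
# The meridian has infinite order in `H₁(S³ ∖ K)`: the framing of a tubular neighbourhood is well defined

Sibling proof file of `DehnSurgery.lean` / `DehnSurgeryFramingProofs.lean` (D-0014: named facts
`def X : Prop` are discharged as `theorem X_holds : X`). `DehnSurgeryFramingProofs.lean` proved the
existence of the framing integer of an oriented tubular neighbourhood `ν` of a smooth knot `K`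
(the knot group is normally generated by the meridian) and reduced the named fact
`Literature.Topology.FourManifolds.Knot.TubularNbhd.existsUnique_hasFraming` (Rolfsen, *Knots and Links*, §5.D Thm 2, §9.F) to
the leaf `Literature.Topology.FourManifolds.Knot.TubularNbhd.zpow_meridian_injective` (*the meridian has infinite order in the
abelianised knot group*; Crowell–Fox, *Introduction to Knot Theory*, Ch. VIII (1.2)). This file
**proves the leaf** and hence the target fact:

* `Literature.Topology.FourManifolds.Knot.TubularNbhd.zpow_abelianization_meridian_injective` (**proved**): for every smooth knot
  `K` and oriented tubular neighbourhood `ν`, `m ↦ [ν.meridian]ᵃᵇ ^ m` is injective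
  `ℤ → π₁(S³ ∖ K, p₀)ᵃᵇ`;
* `Literature.Topology.FourManifolds.Knot.TubularNbhd.zpow_meridian_injective_holds`, and
  **`Literature.Knot.TubularNbhd.existsUnique_hasFraming_holds : ν.existsUnique_hasFraming`**.

## Proof (Crowell–Fox VIII (1.2) construct `θ : G ↠ ℤ` from an over presentation; here: Hurewicz and Mayer–Vietoris)

By the degree-one Hurewicz homomorphism `h : π₁ᵃᵇ → H₁(−; ℤ)`
(`Literature/AlgebraicTopology/SingularHomology/HurewiczOne.lean`,
`zpow_abelianization_injective_of_loopClass`) it suffices that `k • h(μ) = 0` in `H₁(S³ ∖ K; ℤ)`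
forces `k = 0` (`smul_loopClass_meridian_injective`). Mayer–Vietoris for the open cover
`S³ = U ∪ V`, `U = S³ ∖ K`, `V = ν(S¹ × ℝ²)` (open by invariance of domain), in Mathlib's singular
homology (`Literature/AlgebraicTopology/SingularHomology/ExcisionMayerVietoris.lean`, exactness
**proved** in `…MayerVietorisExactness`, excision in `…ExcisionTheorem`):
`H₂(S³) →δ H₁(U ∩ V) →φ H₁(U) ⊕ H₁(V)` is exact and `H₂(S³; ℤ) = 0` (`…ExcisionMayerVietorisProofs`,
Hatcher Cor. 2.14), so `φ` is injective (`mono_mayerVietoris_φ`). The meridian is a loop `μ₀` of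
`U ∩ V` (`meridianInter`); `φ(h μ₀) = (h μ, -h μ_V)` with `μ_V` null-homotopic in the tube
(`meridianInter_map_right_homotopic_refl`: it is the image of a loop of the fibre `ℝ²`), so
`k • h(μ) = 0` gives `k • h(μ₀) = 0` (`smul_loopClass_meridianInter_eq_zero`). Finally the fibre
coordinate `U ∩ V → ℂ ∖ 0`, `ν(x, w) ↦ w` (`fibreCoord`) maps `μ₀` onto the winding loop
`t ↦ ½ e^{2πit}`, whose Hurewicz class has infinite order in `H₁(ℂ ∖ 0; ℤ)` by the winding functional
(`Literature.AlgebraicTopology.SingularHomology.loopClass_windingLoop_smul_injective`, `HurewiczOne.lean`). Hence `k = 0`.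

## References

* R. H. Crowell, R. H. Fox, *Introduction to Knot Theory* (1963; GTM 57, 1977), Ch. VIII (1.2)
  [CrowellFox1963].
* D. Rolfsen, *Knots and Links* (1976), §5.D Thm 2, §9.F [Rolfsen1976].
* A. Hatcher, *Algebraic Topology* (2002), §2.2 (Mayer–Vietoris), Cor. 2.14, Thm. 2A.1
  [HatcherAT2002].

## Design notes

* `mvU K = (K.complement : Set S³)` and `mvV ν = range ν` are `abbrev`s, so that
  `singularHomology ℤ ℤ ↥(mvU K) 1` is `H₁` of the knot complement `↥K.complement` definitionally and
  the Mayer–Vietoris maps of `…ExcisionMayerVietoris` apply verbatim.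
* Integer multiples of homology classes are `zsmul` (see the design notes of `HurewiczOne.lean`).
* No declaration in this file uses `sorry`; `existsUnique_hasFraming_holds` depends only on the
  axioms `propext`, `Classical.choice`, `Quot.sound`.
-/

noncomputable section

open CategoryTheory

namespace Literature.Topology.FourManifolds

/-! ### The meridian has infinite order in `H₁(S³ ∖ K)` -/

section Meridian

open Complex Set Literature.AlgebraicTopology.SingularHomology.SingularSimplex Literature.AlgebraicTopology.FundamentalGroup.PuncturedPlane PlaneComplex Limits

/-- Local notation: `𝔼 n` is the model Euclidean space `EuclideanSpace ℝ (Fin n)`. -/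
local notation "𝔼 " n:arg => EuclideanSpace ℝ (Fin n)

/-- Local notation: `𝕊 n` is the unit sphere in `EuclideanSpace ℝ (Fin (n + 1))`. -/
local notation "𝕊 " n:arg => (Metric.sphere (0 : EuclideanSpace ℝ (Fin (n + 1))) 1)

namespace Knot.TubularNbhd

variable {K : Knot} (ν : Knot.TubularNbhd K)

/-- The two open pieces of the Mayer–Vietoris decomposition `S³ = (S³ ∖ K) ∪ ν(S¹ × ℝ²)`: the knot
complement. [folklore] -/
abbrev mvU (K : Knot) : Set (𝕊 3) := (K.complement : Set (𝕊 3))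

/-- The two open pieces of the Mayer–Vietoris decomposition: the open tube `ν(S¹ × ℝ²)`.
[folklore] -/
abbrev mvV : Set (𝕊 3) := Set.range ν

/-- The interiors of the two pieces cover `S³`. [folklore] -/
theorem interior_mvU_union_interior_mvV : interior (mvU K) ∪ interior ν.mvV = univ := by
  rw [K.complement.isOpen.interior_eq, ν.isOpen_range.interior_eq]
  refine eq_univ_of_forall fun a => ?_
  by_cases ha : a ∈ Set.range K
  · exact Or.inr (ν.range_subset_range ha)
  · exact Or.inl ha

/-- The base point `p₀` as a point of the intersection `(S³ ∖ K) ∩ ν(S¹ × ℝ²)`. [folklore] -/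
def basePointInter : ↥(mvU K ∩ ν.mvV) :=
  ⟨ν.basePoint, ν.basePoint.2, mem_range_self _⟩

/-- The meridian as a loop in the intersection `(S³ ∖ K) ∩ ν(S¹ × ℝ²)`. [folklore] -/
def meridianInter : Path ν.basePointInter ν.basePointInter where
  toFun θ := ⟨ν.meridian θ, (ν.meridian θ).2, mem_range_self _⟩
  continuous_toFun := (continuous_subtype_val.comp ν.meridian.continuous).subtype_mk _
  source' := Subtype.ext (by simp only [Path.source]; rfl)
  target' := Subtype.ext (by simp only [Path.target]; rfl)

/-- Value of `meridianInter`. [folklore] -/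
@[simp] theorem coe_meridianInter (θ : unitInterval) :
    ((ν.meridianInter θ : ↥(mvU K ∩ ν.mvV)) : 𝕊 3) = ν.meridian θ := rfl

/-- In `S³ ∖ K`, `meridianInter` is the meridian. [folklore] -/
theorem meridianInter_map_left :
    ν.meridianInter.map (Literature.AlgebraicTopology.SingularHomology.subsetInclusion (inter_subset_left : mvU K ∩ ν.mvV ⊆ mvU K)).continuous =
      ν.meridian := by
  ext θ
  rfl

/-- The homeomorphism `S¹ × ℝ² ≃ₜ ν(S¹ × ℝ²)` onto the open tube. [folklore] -/
def tubeHomeomorph : (𝕊 1) × 𝔼 2 ≃ₜ ↥ν.mvV :=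
  ν.isSmoothEmbedding_coe.isEmbedding.toHomeomorph

/-- Underlying point of `tubeHomeomorph`. [folklore] -/
@[simp] theorem coe_tubeHomeomorph (p : (𝕊 1) × 𝔼 2) : (ν.tubeHomeomorph p : 𝕊 3) = ν p := rfl

/-- `tubeHomeomorph.symm` inverts `ν`. [folklore] -/
theorem tubeHomeomorph_symm_apply (p : (𝕊 1) × 𝔼 2) (h : ν p ∈ ν.mvV) :
    ν.tubeHomeomorph.symm ⟨ν p, h⟩ = p := by
  have : (⟨ν p, h⟩ : ↥ν.mvV) = ν.tubeHomeomorph p := Subtype.ext rfl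
  rw [this, Homeomorph.symm_apply_apply]

/-- **The meridian is null-homotopic in the tube** `ν(S¹ × ℝ²)`: it is the image of a loop of the
contractible fibre `ℝ²`. [folklore] -/
theorem meridianInter_map_right_homotopic_refl :
    (ν.meridianInter.map (Literature.AlgebraicTopology.SingularHomology.subsetInclusion (inter_subset_right : mvU K ∩ ν.mvV ⊆ ν.mvV)).continuous).Homotopic
      (Path.refl _) := by
  -- the fibre loop in `ℝ²`
  let w : Path framingBaseVector framingBaseVector :=
    { toFun := fun θ => (1 / 2 : ℝ) • ((circlePoint (2 * Real.pi * θ) : 𝕊 1) : 𝔼 2)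
      continuous_toFun := by fun_prop
      source' := by simp [framingBaseVector]
      target' := by
        simp only [Set.Icc.coe_one, framingBaseVector, circlePoint_two_pi_mul_one] }
  let g : C(𝔼 2, ↥ν.mvV) := ⟨fun v => ν.tubeHomeomorph (circlePoint 0, v), by fun_prop⟩
  have hw : w.Homotopic (Path.refl _) := SimplyConnectedSpace.paths_homotopic _ _
  have e : ν.meridianInter.map (Literature.AlgebraicTopology.SingularHomology.subsetInclusion
      (inter_subset_right : mvU K ∩ ν.mvV ⊆ ν.mvV)).continuous = w.map g.continuous := by
    ext θ
    rfl
  rw [e]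
  exact hw.map g

/-- `H₂(S³; ℤ) = 0`. [folklore] -/
theorem isZero_singularHomology_sphere_three_two :
    IsZero (Literature.AlgebraicTopology.SingularHomology.singularHomology ℤ ℤ (𝕊 3) 2) :=
  Literature.AlgebraicTopology.SingularHomology.isZero_singularHomology_sphere_holds ℤ ℤ (n := 3) (k := 2) two_ne_zero (by norm_num)

/-- **Mayer–Vietoris: `H₁((S³ ∖ K) ∩ ν(S¹ × ℝ²)) → H₁(S³ ∖ K) ⊕ H₁(ν(S¹ × ℝ²))` is injective**,
since `H₂(S³) = 0` (Hatcher 2002, §2.2). [folklore] -/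
theorem mono_mayerVietoris_φ :
    Mono (Literature.AlgebraicTopology.SingularHomology.mayerVietoris.φ ℤ ℤ (mvU K) ν.mvV 1) := by
  have hexc := Literature.AlgebraicTopology.SingularHomology.relativeSingularHomology.isIso_map_of_interior_union_interior_holds ℤ ℤ (𝕊 3)
  have hδ : Literature.AlgebraicTopology.SingularHomology.mayerVietoris.δ ℤ ℤ (mvU K) ν.mvV hexc ν.interior_mvU_union_interior_mvV 1 = 0 :=
    isZero_singularHomology_sphere_three_two.eq_of_src _ _
  exact (Literature.AlgebraicTopology.SingularHomology.mayerVietoris.exact₃_holds ℤ ℤ (mvU K) ν.mvV hexc ν.interior_mvU_union_interior_mvV 1).mono_g hδ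

/-- If a multiple of the Hurewicz class of the meridian vanishes in `H₁(S³ ∖ K; ℤ)`, the same
multiple of the class of the meridian vanishes in `H₁` of the punctured tube. [folklore] -/
theorem smul_loopClass_meridianInter_eq_zero {k : ℤ}
    (hk : k • Literature.AlgebraicTopology.SingularHomology.loopClass ℤ ℤ (1 : ℤ) ν.meridian = 0) :
    k • Literature.AlgebraicTopology.SingularHomology.loopClass ℤ ℤ (1 : ℤ) ν.meridianInter = 0 := by
  haveI := ν.mono_mayerVietoris_φ
  have hinj := (ModuleCat.mono_iff_injective (Literature.AlgebraicTopology.SingularHomology.mayerVietoris.φ ℤ ℤ (mvU K) ν.mvV 1)).1 inferInstance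
  apply hinj
  rw [map_zero]
  refine Literature.AlgebraicTopology.SingularHomology.biprod_apply_ext ?_ ?_
  · rw [map_zero, Literature.AlgebraicTopology.SingularHomology.mayerVietoris.φ, Literature.AlgebraicTopology.SingularHomology.biprod_fst_lift_apply, map_zsmul, Literature.AlgebraicTopology.SingularHomology.map_loopClass,
      meridianInter_map_left]
    exact hk
  · rw [map_zero, Literature.AlgebraicTopology.SingularHomology.mayerVietoris.φ, Literature.AlgebraicTopology.SingularHomology.biprod_snd_lift_apply]
    change -(Literature.AlgebraicTopology.SingularHomology.singularHomology.map ℤ ℤ (Literature.AlgebraicTopology.SingularHomology.subsetInclusion inter_subset_right) 1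
      (k • Literature.AlgebraicTopology.SingularHomology.loopClass ℤ ℤ (1 : ℤ) ν.meridianInter)) = 0
    rw [map_zsmul, Literature.AlgebraicTopology.SingularHomology.map_loopClass, Literature.AlgebraicTopology.SingularHomology.loopClass_eq_of_homotopic ℤ ℤ 1
      ν.meridianInter_map_right_homotopic_refl, Literature.AlgebraicTopology.SingularHomology.loopClass_refl]
    rw [zsmul_zero, neg_zero]

/-- The **fibre coordinate** of the punctured tube: `(S³ ∖ K) ∩ ν(S¹ × ℝ²) → ℂ ∖ 0`,
`ν (x, w) ↦ w` (plane identified with `ℂ`). [folklore] -/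
def fibreCoord : C(↥(mvU K ∩ ν.mvV), CStar) where
  toFun y := ⟨toC (ν.tubeHomeomorph.symm ⟨y, y.2.2⟩).2, fun h => y.2.1 (by
    obtain ⟨p, hp⟩ := y.2.2
    have hy : ν.tubeHomeomorph.symm ⟨y, y.2.2⟩ = p := by
      rw [← ν.tubeHomeomorph_symm_apply p (mem_range_self p)]
      congr 1
      exact Subtype.ext hp.symm
    rw [hy] at h
    have h2 : p.2 = 0 := toC_injective (h.trans (Complex.ext rfl rfl : (0 : ℂ) = toC 0))
    refine ⟨p.1, ?_⟩
    rw [← ν.coe_apply_zero, ← hp]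
    congr 1
    exact Prod.ext rfl h2.symm)⟩
  continuous_toFun := (continuous_toC.comp (continuous_snd.comp
    (ν.tubeHomeomorph.symm.continuous.comp (continuous_subtype_val.subtype_mk _)))).subtype_mk _

/-- The fibre coordinate of the meridian is the winding loop `t ↦ ½ e^{2πit}` (as singular
`1`-simplices). [folklore] -/
theorem ofPath_meridianInter_map_fibreCoord :
    ofPath (ν.meridianInter.map ν.fibreCoord.continuous) =
      ofPath (windingLoop (1 / 2) one_half_pos 1) := by
  apply toContinuousMap_injective
  ext s : 1
  rw [ofPath_apply, ofPath_apply]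
  apply Subtype.ext
  change toC (ν.tubeHomeomorph.symm ⟨ν.meridian (Literature.AlgebraicTopology.SingularHomology.StdSimplex.toUnitInterval s), _⟩).2 =
    (windingLoop (1 / 2) one_half_pos 1 (Literature.AlgebraicTopology.SingularHomology.StdSimplex.toUnitInterval s) : ℂ)
  have h : (⟨(ν.meridian (Literature.AlgebraicTopology.SingularHomology.StdSimplex.toUnitInterval s) : 𝕊 3), mem_range_self _⟩ : ↥ν.mvV) =
      ν.tubeHomeomorph (circlePoint 0, (1 / 2 : ℝ) •
        ((circlePoint (2 * Real.pi * Literature.AlgebraicTopology.SingularHomology.StdSimplex.toUnitInterval s) : 𝕊 1) : 𝔼 2)) :=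
    Subtype.ext rfl
  rw [h, Homeomorph.symm_apply_apply, toC_polar, windingLoop_apply_coe]
  simp

/-- **The Hurewicz class of the meridian has infinite order in `H₁(S³ ∖ K; ℤ)`.** [folklore] -/
theorem smul_loopClass_meridian_injective :
    Function.Injective fun k : ℤ => k • Literature.AlgebraicTopology.SingularHomology.loopClass ℤ ℤ (1 : ℤ) ν.meridian := by
  -- it suffices that `k • h(μ) = 0` forces `k = 0`
  suffices key : ∀ k : ℤ, k • Literature.AlgebraicTopology.SingularHomology.loopClass ℤ ℤ (1 : ℤ) ν.meridian = 0 → k = 0 by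
    intro k l hkl
    have := key (k - l) (by rw [sub_zsmul, add_neg_eq_zero]; exact hkl)
    omega
  intro k hk
  have h1 := ν.smul_loopClass_meridianInter_eq_zero hk
  have h2 := congrArg (Literature.AlgebraicTopology.SingularHomology.singularHomology.map ℤ ℤ ν.fibreCoord 1) h1
  rw [map_zsmul, map_zero, Literature.AlgebraicTopology.SingularHomology.map_loopClass,
    Literature.AlgebraicTopology.SingularHomology.loopClass_eq_of_ofPath_eq ℤ ℤ 1 _ _ ν.ofPath_meridianInter_map_fibreCoord] at h2
  have h3 := Literature.AlgebraicTopology.SingularHomology.loopClass_windingLoop_smul_injective (1 / 2) one_half_pos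
    (a₁ := k) (a₂ := 0) (by simpa using h2)
  exact h3

/-- **The meridian has infinite order in `π₁(S³ ∖ K)ᵃᵇ`**: `m ↦ [meridian]ᵃᵇ ^ m` is injective
(Crowell–Fox, Ch. VIII (1.2)). [cite: CrowellFox1963, Ch. VIII (1.2)] -/
theorem zpow_abelianization_meridian_injective :
    Function.Injective fun m : ℤ => (Abelianization.of
      (FundamentalGroup.fromPath (Path.Homotopic.Quotient.mk ν.meridian))) ^ m :=
  Literature.AlgebraicTopology.SingularHomology.zpow_abelianization_injective_of_loopClass ℤ ℤ 1 _ ν.smul_loopClass_meridian_injective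

end Knot.TubularNbhd

end Meridian

/-! ### Discharge of the leaf and of the target fact -/

section Discharge

/-- **Discharge of the leaf `Knot.TubularNbhd.zpow_meridian_injective`** (Crowell–Fox, Ch. VIII
(1.2): the meridian has infinite order in the abelianised knot group), by
`Knot.TubularNbhd.zpow_abelianization_meridian_injective`. [cite: CrowellFox1963, Ch. VIII (1.2)] -/
theorem Knot.TubularNbhd.zpow_meridian_injective_holds : Knot.TubularNbhd.zpow_meridian_injective :=
  fun _ ν => ν.zpow_abelianization_meridian_injective

/-- **Discharge of the named fact `Knot.TubularNbhd.existsUnique_hasFraming`** (`DehnSurgery.lean`;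
Rolfsen, *Knots and Links* (1976), §5.D Thm 2, §9.F: the framing of an oriented tubular
neighbourhood of a smooth knot is a well-defined integer): existence by
`Knot.TubularNbhd.exists_hasFraming` (the knot group is normally generated by the meridian,
van Kampen), uniqueness by `Knot.TubularNbhd.zpow_meridian_injective_holds` (the meridian has
infinite order in `H₁(S³ ∖ K)`, Hurewicz and Mayer–Vietoris). [cite: Rolfsen1976, §5.D Thm 2]
[cite: CrowellFox1963, Ch. VIII (1.1)–(1.2)] -/
theorem Knot.TubularNbhd.existsUnique_hasFraming_holds {K : Knot} (ν : Knot.TubularNbhd K) :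
    ν.existsUnique_hasFraming :=
  ν.existsUnique_hasFraming_of Knot.TubularNbhd.zpow_meridian_injective_holds

end Discharge

end Literature.Topology.FourManifolds
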